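import Literature.MathematicalPhysics.QuantumLattice.InfVolFermionState
import Literature.MathematicalPhysics.QuantumLattice.HubbardModelParticleHoleProofs
import Literature.MathematicalPhysics.QuantumLattice.HubbardTorus2DEnergyDensity
import HarnessLib

/-!
# The particle density of a thermodynamic-limit state of fixed-particle-number torus families

Topic `Literature/MathematicalPhysics/QuantumLattice`; namespace
`Literature.MathematicalPhysics.QuantumLattice` (the file path). Companion of
`InfVolFermionState.lean` / `InfVolFermionStateCompactness.lean` (definition request
`defn-InfVolFermionState`, route `HubbardSuperconductivity/InfiniteVolumeFirst`, crux
`NoNormalLimitState`, idea `bkr-minimiser-exclusion`, first half of its stub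
`TorusLimitMinimises`: "the torus limit has density `1 - δ`"). Everything is PROVED; no definition,
no named fact.

## Results

* `torusAvgExpect_nAt_add_nAt`: for an `N`-particle unit vector `ψ` of the torus of side `L ≠ 0`,
  the translation-averaged expectation of the local density observable `n_{0↑} + n_{0↓} ∈ 𝔄_{{0}}`
  is EXACTLY `N / L^d` (the translates of `n_0` sum to the total number operator).
* `InfVolFermionState.IsTorusLimitOf.density_eq`: hence every torus limit `ω` (along `Ls → ∞`) of a
  family of `N_L`-particle unit vectors with `N_{Ls j}/(Ls j)^d → ρ` has particle density
  `ω.density = ρ`.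
* `ThermodynamicLimit.tendsto_rectN_div_sq`: `2⌊nL²/2⌋ / L² → n`; so
  (`IsTorusLimitOf.density_eq_of_rectN`) torus limits of the two-dimensional families with
  `N_L = 2⌊nL²/2⌋` particles (the particle numbers of `energyDensity2D` and of the summit
  `HubbardSuperconductivity`, `n = 1 - δ`) have density `n`.

Bratteli–Robinson II §6.2.2 (densities of thermodynamic-limit states); Ruelle (1969) §3.3–3.4.

## What is NOT here

The energy density of torus limits and the variational (minimiser) property — the remaining parts
of `TorusLimitMinimises` — are separate files.
-/

noncomputable section

namespace Literature.MathematicalPhysics.QuantumLattice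

open Matrix Finset HubbardWave0 _root_.Filter Literature.Probability.LatticeModels
open scoped _root_.Topology ComplexOrder

variable {d : ℕ}

/-! ### The translates of the local density sum to the particle number -/

/-- `x ↦ x mod L` is injective on a one-point region. [folklore] -/
theorem injOn_proj_singleton (L : ℕ) (x : Site d) :
    Set.InjOn (Torus.proj (d := d) L) ↑({x} : Finset (Site d)) := by
  rw [Finset.coe_singleton]
  exact Set.injOn_singleton _ _

/-- **The translates of `n_{0σ}` exhaust the number operators of spin `σ`**: for an `L ≠ 0` torus
vector `ψ`, `Σ_v ⟨U_v ψ, n_{0σ} U_v ψ⟩ = ⟨ψ, (Σ_y n_{yσ}) ψ⟩`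
(`U_vᴴ n_{0σ} U_v = n_{-v,σ}`, then reindex `v ↦ -v`). [folklore] -/
theorem sum_expect_numberOp_fockTranslate (L : ℕ) [NeZero L] (σ : Fin 2)
    (ψ : Fock (Orb (FermionTorus d L))) :
    ∑ v : TorusSite d L, expect (numberOp (FermionTorus.ofTorusSite (0 : TorusSite d L)) σ)
        ((fockTranslate v).val *ᵥ ψ) =
      expect (∑ y : FermionTorus d L, numberOp y σ) ψ := by
  have hstep : ∀ v : TorusSite d L,
      expect (numberOp (FermionTorus.ofTorusSite (0 : TorusSite d L)) σ) ((fockTranslate v).val *ᵥ ψ) =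
        expect (numberOp (FermionTorus.ofTorusSite (-v)) σ) ψ := by
    intro v
    rw [expect_fockRelabel_mulVec, ← Equiv.Perm.inv_def, ← Orb.translate_neg,
      relabel_translate_numberOp, zero_add]
  simp_rw [hstep]
  have hsum : ∀ φ : Fock (Orb (FermionTorus d L)),
      expect (∑ y : FermionTorus d L, numberOp y σ) φ = ∑ y : FermionTorus d L, expect (numberOp y σ) φ := by
    intro φ
    rw [expect, Matrix.sum_mulVec, dotProduct_sum]
    rfl
  rw [hsum]
  exact Fintype.sum_equiv ((Equiv.neg (TorusSite d L)).trans FermionTorus.equivTorusSite.symm) _ _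
    fun v => rfl

/-- **The averaged local density of an `N`-particle unit vector is `N/L^d`**: for `L ≠ 0`, the
translation-averaged expectation of `n_{0↑} + n_{0↓} ∈ 𝔄_{{0}}` in an `N`-particle unit vector of
the torus of side `L` equals `N / L^d`. (Bratteli–Robinson II §6.2.2.) [folklore] -/
theorem torusAvgExpect_nAt_add_nAt (L : ℕ) [NeZero L] {N : ℕ} {ψ : Fock (Orb (FermionTorus d L))}
    (hN : IsNParticle N ψ) (hψ : star ψ ⬝ᵥ ψ = 1) :
    torusAvgExpect L ({0} : Finset (Site d))
        (nAt 0 (Finset.mem_singleton_self 0) 0 + nAt 0 (Finset.mem_singleton_self 0) 1) ψ =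
      (N : ℂ) / ((L : ℂ) ^ d) := by
  have h := injOn_proj_singleton (d := d) L 0
  have hcard : Fintype.card (TorusSite d L) = L ^ d := by simp [ZMod.card, Fintype.card_fin]
  have hproj : Torus.proj L (0 : Site d) = 0 := by funext i; simp [Torus.proj]
  rw [torusAvgExpect_eq, torusAvgExpectAt_of_injOn L h, hcard, Nat.cast_pow,
    div_eq_inv_mul]
  congr 1
  rw [fermionEmbed_add]
  have hn : ∀ σ : Fin 2, fermionEmbed (PolySite.toTorusEmb L h) (nAt 0 (Finset.mem_singleton_self 0) σ) =
      numberOp (FermionTorus.ofTorusSite (0 : TorusSite d L)) σ := by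
    intro σ
    rw [nAt, fermionEmbed_numberOp, PolySite.toTorusEmb_apply, PolySite.ofLex_coe_pt, hproj]
  rw [hn 0, hn 1]
  have hadd : ∀ φ : Fock (Orb (FermionTorus d L)),
      expect (numberOp (FermionTorus.ofTorusSite (0 : TorusSite d L)) 0 +
          numberOp (FermionTorus.ofTorusSite (0 : TorusSite d L)) 1) φ =
        expect (numberOp (FermionTorus.ofTorusSite (0 : TorusSite d L)) 0) φ +
          expect (numberOp (FermionTorus.ofTorusSite (0 : TorusSite d L)) 1) φ := by
    intro φ
    rw [expect, expect, expect, Matrix.add_mulVec, dotProduct_add]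
  simp_rw [hadd]
  rw [Finset.sum_add_distrib, sum_expect_numberOp_fockTranslate, sum_expect_numberOp_fockTranslate,
    expect, expect, ← dotProduct_add, ← Matrix.add_mulVec]
  have htot : (∑ y : FermionTorus d L, numberOp y 0) + ∑ y : FermionTorus d L, numberOp y 1 =
      (totalNumber : Matrix (Finset (Orb (FermionTorus d L))) (Finset (Orb (FermionTorus d L))) ℂ) := by
    rw [totalNumber, ← Finset.sum_add_distrib]
    refine Finset.sum_congr rfl fun y _ => ?_
    rw [Fin.sum_univ_two]
  rw [htot, totalNumber_mulVec_of_isNParticle hN, dotProduct_smul, hψ, smul_eq_mul, mul_one]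

/-! ### The density of a torus limit -/

/-- **The particle density of a thermodynamic-limit state.** Let `ω` be a torus limit of the family
`ψ` along sides `Ls → ∞`, the `ψ (Ls j)` being `N j`-particle unit vectors with
`N j / (Ls j)^d → ρ`. Then `ω.density = ρ`. (The local density observable `n_{0↑} + n_{0↓}` has
averaged torus expectation exactly `N j/(Ls j)^d`, `torusAvgExpect_nAt_add_nAt`.)
Bratteli–Robinson II §6.2.2; Ruelle (1969) §3.4. [cite: Ruelle1969, §3.4] -/
theorem InfVolFermionState.IsTorusLimitOf.density_eq {ω : InfVolFermionState d}
    {ψ : ∀ L, Fock (Orb (FermionTorus d L))} {Ls : ℕ → ℕ} (h : ω.IsTorusLimitOf ψ Ls)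
    (hLs : Tendsto Ls atTop atTop) {N : ℕ → ℕ} (hN : ∀ j, IsNParticle (N j) (ψ (Ls j)))
    (hψ : ∀ j, star (ψ (Ls j)) ⬝ᵥ ψ (Ls j) = 1) {ρ : ℝ}
    (hρ : Tendsto (fun j => (N j : ℝ) / (Ls j : ℝ) ^ d) atTop (𝓝 ρ)) : ω.density = ρ := by
  have hlim := h ({0} : Finset (Site d))
    (nAt 0 (Finset.mem_singleton_self 0) 0 + nAt 0 (Finset.mem_singleton_self 0) 1)
  have hρ' : Tendsto (fun j => (((N j : ℝ) / (Ls j : ℝ) ^ d : ℝ) : ℂ)) atTop (𝓝 (ρ : ℂ)) :=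
    (Complex.continuous_ofReal.tendsto ρ).comp hρ
  have heq : ∀ᶠ j in atTop, torusAvgExpect (Ls j) ({0} : Finset (Site d))
      (nAt 0 (Finset.mem_singleton_self 0) 0 + nAt 0 (Finset.mem_singleton_self 0) 1) (ψ (Ls j)) =
        (((N j : ℝ) / (Ls j : ℝ) ^ d : ℝ) : ℂ) := by
    filter_upwards [hLs.eventually_ge_atTop 1] with j hj
    haveI : NeZero (Ls j) := ⟨Nat.one_le_iff_ne_zero.1 hj⟩
    rw [torusAvgExpect_nAt_add_nAt (Ls j) (hN j) (hψ j)]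
    push_cast
    rfl
  have hval : ω.expect {0}
      (nAt 0 (Finset.mem_singleton_self 0) 0 + nAt 0 (Finset.mem_singleton_self 0) 1) = (ρ : ℂ) :=
    tendsto_nhds_unique hlim (hρ'.congr' (heq.mono fun j hj => hj.symm))
  rw [InfVolFermionState.density, InfVolFermionState.densityAt, hval, Complex.ofReal_re]

namespace ThermodynamicLimit

/-- **`N_L(n)/L² → n`** for the even particle numbers `N_L(n) = 2⌊nL²/2⌋` (`rectN`) of density
`n ≥ 0` (`nL² - 2 < N_L(n) ≤ nL²`). [folklore] -/
theorem tendsto_rectN_div_sq {n : ℝ} (hn : 0 ≤ n) :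
    Tendsto (fun L : ℕ => (rectN n L : ℝ) / (L : ℝ) ^ 2) atTop (𝓝 n) := by
  have hlow : Tendsto (fun L : ℕ => n - 2 / (L : ℝ) ^ 2) atTop (𝓝 n) := by
    have h2 : Tendsto (fun L : ℕ => 2 / (L : ℝ) ^ 2) atTop (𝓝 0) := by
      have := (tendsto_pow_atTop (α := ℝ) two_ne_zero).comp tendsto_natCast_atTop_atTop
      simpa using this.const_div_atTop 2
    simpa using tendsto_const_nhds.sub h2
  refine tendsto_of_tendsto_of_tendsto_of_le_of_le' hlow tendsto_const_nhds ?_ ?_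
  · filter_upwards [eventually_ge_atTop 1] with L hL
    have hL2 : (0 : ℝ) < (L : ℝ) ^ 2 := by positivity
    rw [sub_le_iff_le_add, ← sub_le_iff_le_add', le_div_iff₀ hL2, sub_mul,
      div_mul_cancel₀ _ hL2.ne']
    linarith [lt_rectN_add_two n L]
  · filter_upwards [eventually_ge_atTop 1] with L hL
    have hL2 : (0 : ℝ) < (L : ℝ) ^ 2 := by positivity
    rw [div_le_iff₀ hL2]
    exact rectN_le hn L

end ThermodynamicLimit

/-- **Torus limits of the density-`n` families have density `n`** (two dimensions): if the
`ψ (Ls j)` are `2⌊n (Ls j)²/2⌋`-particle unit vectors (`ThermodynamicLimit.rectN`, the particle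
numbers of `energyDensity2D` and of `HubbardSuperconductivity` with `n = 1 - δ`) and `Ls → ∞`, every
torus limit `ω` of `ψ` along `Ls` has `ω.density = n`. [cite: Ruelle1969, §3.4] -/
theorem InfVolFermionState.IsTorusLimitOf.density_eq_of_rectN {ω : InfVolFermionState 2}
    {ψ : ∀ L, Fock (Orb (FermionTorus 2 L))} {Ls : ℕ → ℕ} (h : ω.IsTorusLimitOf ψ Ls)
    (hLs : Tendsto Ls atTop atTop) {n : ℝ} (hn : 0 ≤ n)
    (hN : ∀ j, IsNParticle (ThermodynamicLimit.rectN n (Ls j)) (ψ (Ls j)))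
    (hψ : ∀ j, star (ψ (Ls j)) ⬝ᵥ ψ (Ls j) = 1) : ω.density = n :=
  h.density_eq hLs hN hψ ((ThermodynamicLimit.tendsto_rectN_div_sq hn).comp hLs)

end Literature.MathematicalPhysics.QuantumLattice

end
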